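import Literature.Computability.Complexity.CodeFPModArith
import Literature.Computability.Complexity.CodeFPListKit
import Literature.Computability.Complexity.CodeFPBudgets
import HarnessLib

/-!
# Cube roots modulo a prime on codes, I: the loops of the Adleman–Manders–Miller program

Machine-layer kit in the typed polynomial-time algebra `CodeFP` (`CodeFP*.lean`, `CodeFPModArith.lean`)
for the randomised cube-root program (Adleman–Manders–Miller 1977; mathematics in
`Literature/NumberTheory/ModularRoots/CubeRootsModP.lean`, `CubeRootsAMM.lean`):

* `CodeFP.threeFree` — the `3`-free part of `p - 1` by a loop of `size p` rounds of
  `s ↦ (3 ∣ s ? s/3 : s)` (a fold over a unary budget; the accumulator never grows);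
* `CodeFP.strBlocks` — all full blocks of length `μ` of a string (how a machine reads fixed-size
  fields off its coin string);
* `CodeFP.ammLoop` — the Adleman–Manders–Miller digit iteration on a state `(x, b, c, E)` of
  residues, as a fold over a unary budget with modulus `max q 2` (every component of the state stays
  below `x₀ + b₀ + c₀ + E₀ + max q 2`, which discharges the accumulator bound of `CodeFP.foldl`).

Theorem-only file; independent of the number-theoretic files (pure `CodeFP` programming).

## References

* L. M. Adleman, K. L. Manders, G. L. Miller, *On taking roots in finite fields*, FOCS 1977
  [AdlemanMandersMiller1977].
* S. Arora, B. Barak, *Computational Complexity: A Modern Approach*, CUP 2009, §1.3 (bounded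
  loops), §7.1 (coins of a probabilistic machine) [AroraBarak2009].
-/

namespace Literature.Computability.Complexity

namespace CodeFP

open _root_.Computability Polynomial ModArith

/-- **The `3`-free part loop on codes**: `n ↦` the value after `size n` rounds of
`s ↦ (3 ∣ s ? s / 3 : s)` started at `n - 1` (a fold over a unary budget of `size n` rounds; the
accumulator never grows). [cite: AroraBarak2009, §1.3 (bounded loops)] -/
theorem threeFree : CodeFP natE natE
    (fun n => (fun s => if s % 3 = 0 then s / 3 else s)^[n.size] (n - 1)) := by
  have hacc : CodeFP (pairE natE (pairE unitE natE)) natE (fun t => t.2.2) := (snd _ _).snd'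
  have hstep : CodeFP (pairE natE (pairE unitE natE)) natE
      (fun t => if t.2.2 % 3 = 0 then t.2.2 / 3 else t.2.2) := by
    have hc : CodeFP (pairE natE (pairE unitE natE)) bitE (fun t => decide (t.2.2 % 3 = 0)) :=
      natEq.comp ((natMod.comp (hacc.pair (const _ 3))).pair (const _ 0))
    exact (hc.ite (natDiv.comp (hacc.pair (const _ 3))) hacc).congr fun t => by
      simp only [decide_eq_true_eq]
  have hmono : ∀ (j s₀ : ℕ), (fun s => if s % 3 = 0 then s / 3 else s)^[j] s₀ ≤ s₀ := by
    intro j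
    induction j with
    | zero => intro s₀; simp
    | succ j ih =>
      intro s₀
      rw [Function.iterate_succ_apply']
      refine le_trans ?_ (ih s₀)
      split_ifs
      · exact Nat.div_le_self _ _
      · exact le_rfl
  have h := foldl (σ := ℕ) (α := Unit) (β := ℕ) (eσ := natE) (eα := unitE) (eβ := natE)
    (step := fun _ _ s => if s % 3 = 0 then s / 3 else s) (init := fun n => n - 1) hstep
    (natSub.comp ((CodeFP.id natE).pair (const _ 1))) X (fun n l₁ l₂ => by
      rw [eval_X, pairE_apply, length_boolPair, foldl_units_eq_iterate']
      have h1 := length_natE_mono ((hmono l₁.length (n - 1)).trans (Nat.sub_le n 1))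
      dsimp only at h1 ⊢
      omega)
  refine (h.comp ((CodeFP.id natE).pair (replicateUnit.comp (strLength.comp strOfNat)))).congr
    fun n => ?_
  simp only [id]
  rw [foldl_units_eq_iterate, length_natE]

/-- **All full blocks of a string**: `(1^μ, w) ↦ [w[0, μ), w[μ, 2μ), …]`, the `⌊|w|/μ⌋` consecutive
blocks of length `μ` (how a machine reads fixed-size fields off its coin string).
[cite: AroraBarak2009, §1.3, §7.1] -/
theorem strBlocks : CodeFP (pairE unE strE) (rawE strE)
    (fun q => (List.range (q.2.length / q.1)).map fun i => (q.2.drop (i * q.1)).take q.1) := by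
  have hk : CodeFP (pairE unE strE) unE Prod.fst := fst _ _
  have hw : CodeFP (pairE unE strE) strE Prod.snd := snd _ _
  have hN : CodeFP (pairE unE strE) natE (fun q => q.2.length / q.1) :=
    natDiv.comp ((strNatLength.comp hw).pair (natOfUn.comp hk))
  have hNu : CodeFP (pairE unE strE) unE (fun q => q.2.length / q.1) :=
    (unOfNatMin.comp ((strLength.comp hw).pair hN)).congr fun q => min_eq_left (Nat.div_le_self _ _)
  exact (strChunks.comp (hNu.pair (hk.pair hw))).congr fun q => rfl

/-- **The Adleman–Manders–Miller loop on codes.** Input `((q, z), (x₀, b₀, c₀, E₀), 1ⁿ)`; output the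
state after `n` rounds of the cube-root digit step with modulus `max q 2` and comparison value `z`
(a fold over the unary budget; every component of the state stays below
`x₀ + b₀ + c₀ + E₀ + max q 2`). [cite: AdlemanMandersMiller1977, §2] -/
theorem ammLoop : CodeFP (pairE (pairE natE natE) (pairE (pairE natE (pairE natE (pairE natE natE))) unE))
    (pairE natE (pairE natE (pairE natE natE)))
    (fun w => (fun st : ℕ × ℕ × ℕ × ℕ =>
      if powM (max w.1.1 2) st.2.1 st.2.2.2 = 1 then
        (st.1, st.2.1, powM (max w.1.1 2) st.2.2.1 3, st.2.2.2 / 3)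
      else if powM (max w.1.1 2) st.2.1 st.2.2.2 = w.1.2 then
        (mulM (max w.1.1 2) st.1 (powM (max w.1.1 2) st.2.2.1 2),
          mulM (max w.1.1 2) st.2.1 (powM (max w.1.1 2) st.2.2.1 6),
          powM (max w.1.1 2) st.2.2.1 3, st.2.2.2 / 3)
      else (mulM (max w.1.1 2) st.1 st.2.2.1, mulM (max w.1.1 2) st.2.1 (powM (max w.1.1 2) st.2.2.1 3),
          powM (max w.1.1 2) st.2.2.1 3, st.2.2.2 / 3))^[w.2.2] w.2.1) := by
  -- the typed record of one round: `t = (((q, z), init), (), (x, b, c, E))`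
  let eS : ℕ × ℕ × ℕ × ℕ → List Bool := pairE natE (pairE natE (pairE natE natE))
  let eσ : (ℕ × ℕ) × (ℕ × ℕ × ℕ × ℕ) → List Bool := pairE (pairE natE natE) eS
  let eT : ((ℕ × ℕ) × (ℕ × ℕ × ℕ × ℕ)) × Unit × (ℕ × ℕ × ℕ × ℕ) → List Bool := pairE eσ (pairE unitE eS)
  have hQ : CodeFP eT natE (fun t => max t.1.1.1 2) := natMax.comp (((fst _ _).fst').fst'.pair (const _ 2))
  have hz : CodeFP eT natE (fun t => t.1.1.2) := ((fst _ _).fst').snd'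
  have hx : CodeFP eT natE (fun t => t.2.2.1) := ((snd _ _).snd').fst'
  have hb : CodeFP eT natE (fun t => t.2.2.2.1) := ((snd _ _).snd').snd'.fst'
  have hc : CodeFP eT natE (fun t => t.2.2.2.2.1) := ((snd _ _).snd').snd'.snd'.fst'
  have hE : CodeFP eT natE (fun t => t.2.2.2.2.2) := ((snd _ _).snd').snd'.snd'.snd'
  have hd : CodeFP eT natE (fun t => powM (max t.1.1.1 2) t.2.2.2.1 t.2.2.2.2.2) := modPow hQ hb hE
  have hc2 : CodeFP eT natE (fun t => powM (max t.1.1.1 2) t.2.2.2.2.1 2) := modPow hQ hc (const _ 2)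
  have hc3 : CodeFP eT natE (fun t => powM (max t.1.1.1 2) t.2.2.2.2.1 3) := modPow hQ hc (const _ 3)
  have hc6 : CodeFP eT natE (fun t => powM (max t.1.1.1 2) t.2.2.2.2.1 6) := modPow hQ hc (const _ 6)
  have hE3 : CodeFP eT natE (fun t => t.2.2.2.2.2 / 3) := natDiv.comp (hE.pair (const _ 3))
  have hbr1 : CodeFP eT eS (fun t => (t.2.2.1, t.2.2.2.1, powM (max t.1.1.1 2) t.2.2.2.2.1 3, t.2.2.2.2.2 / 3)) :=
    hx.pair (hb.pair (hc3.pair hE3))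
  have hbr2 : CodeFP eT eS (fun t => (mulM (max t.1.1.1 2) t.2.2.1 (powM (max t.1.1.1 2) t.2.2.2.2.1 2),
      mulM (max t.1.1.1 2) t.2.2.2.1 (powM (max t.1.1.1 2) t.2.2.2.2.1 6),
      powM (max t.1.1.1 2) t.2.2.2.2.1 3, t.2.2.2.2.2 / 3)) :=
    (modMul hQ hx hc2).pair ((modMul hQ hb hc6).pair (hc3.pair hE3))
  have hbr3 : CodeFP eT eS (fun t => (mulM (max t.1.1.1 2) t.2.2.1 t.2.2.2.2.1,
      mulM (max t.1.1.1 2) t.2.2.2.1 (powM (max t.1.1.1 2) t.2.2.2.2.1 3),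
      powM (max t.1.1.1 2) t.2.2.2.2.1 3, t.2.2.2.2.2 / 3)) :=
    (modMul hQ hx hc).pair ((modMul hQ hb hc3).pair (hc3.pair hE3))
  have hcond1 : CodeFP eT bitE (fun t => decide (powM (max t.1.1.1 2) t.2.2.2.1 t.2.2.2.2.2 = 1)) :=
    natEq.comp (hd.pair (const _ 1))
  have hcond2 : CodeFP eT bitE (fun t => decide (powM (max t.1.1.1 2) t.2.2.2.1 t.2.2.2.2.2 = t.1.1.2)) :=
    natEq.comp (hd.pair hz)
  -- one round, as a function of (context, accumulator)
  have hstep : CodeFP eT eS (fun t =>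
      if powM (max t.1.1.1 2) t.2.2.2.1 t.2.2.2.2.2 = 1 then
        (t.2.2.1, t.2.2.2.1, powM (max t.1.1.1 2) t.2.2.2.2.1 3, t.2.2.2.2.2 / 3)
      else if powM (max t.1.1.1 2) t.2.2.2.1 t.2.2.2.2.2 = t.1.1.2 then
        (mulM (max t.1.1.1 2) t.2.2.1 (powM (max t.1.1.1 2) t.2.2.2.2.1 2),
          mulM (max t.1.1.1 2) t.2.2.2.1 (powM (max t.1.1.1 2) t.2.2.2.2.1 6),
          powM (max t.1.1.1 2) t.2.2.2.2.1 3, t.2.2.2.2.2 / 3)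
      else (mulM (max t.1.1.1 2) t.2.2.1 t.2.2.2.2.1, mulM (max t.1.1.1 2) t.2.2.2.1 (powM (max t.1.1.1 2) t.2.2.2.2.1 3),
          powM (max t.1.1.1 2) t.2.2.2.2.1 3, t.2.2.2.2.2 / 3)) :=
    (hcond1.ite hbr1 (hcond2.ite hbr2 hbr3)).congr fun t => by simp only [decide_eq_true_eq]
  -- the fold
  have hfold := foldl (σ := (ℕ × ℕ) × (ℕ × ℕ × ℕ × ℕ)) (α := Unit) (β := ℕ × ℕ × ℕ × ℕ) (eσ := eσ)
    (eα := unitE) (eβ := eS)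
    (step := fun σ _ st =>
      if powM (max σ.1.1 2) st.2.1 st.2.2.2 = 1 then
        (st.1, st.2.1, powM (max σ.1.1 2) st.2.2.1 3, st.2.2.2 / 3)
      else if powM (max σ.1.1 2) st.2.1 st.2.2.2 = σ.1.2 then
        (mulM (max σ.1.1 2) st.1 (powM (max σ.1.1 2) st.2.2.1 2),
          mulM (max σ.1.1 2) st.2.1 (powM (max σ.1.1 2) st.2.2.1 6),
          powM (max σ.1.1 2) st.2.2.1 3, st.2.2.2 / 3)
      else (mulM (max σ.1.1 2) st.1 st.2.2.1, mulM (max σ.1.1 2) st.2.1 (powM (max σ.1.1 2) st.2.2.1 3),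
          powM (max σ.1.1 2) st.2.2.1 3, st.2.2.2 / 3))
    (init := fun σ => σ.2) hstep (snd _ _) (7 * X + 27) (fun σ l₁ l₂ => by
      obtain ⟨⟨q, z⟩, x₀, b₀, c₀, E₀⟩ := σ
      rw [foldl_units_eq_iterate']
      set M := x₀ + b₀ + c₀ + E₀ + max q 2 with hM
      have hQ2 : 2 ≤ max q 2 := le_max_right _ _
      have hmul : ∀ u v, mulM (max q 2) u v ≤ M := fun u v =>
        ((Nat.mod_lt _ (by omega)).le.trans (by omega))
      have hpow : ∀ u v, powM (max q 2) u v ≤ M := fun u v => by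
        have h : powM (max q 2) u v < max q 2 := by
          rw [powM, if_pos hQ2]; exact Nat.mod_lt _ (by omega)
        exact h.le.trans (by omega)
      have hinv : ∀ n : ℕ, ∀ st : ℕ × ℕ × ℕ × ℕ, st = (fun st : ℕ × ℕ × ℕ × ℕ =>
          if powM (max q 2) st.2.1 st.2.2.2 = 1 then
            (st.1, st.2.1, powM (max q 2) st.2.2.1 3, st.2.2.2 / 3)
          else if powM (max q 2) st.2.1 st.2.2.2 = z then
            (mulM (max q 2) st.1 (powM (max q 2) st.2.2.1 2),
              mulM (max q 2) st.2.1 (powM (max q 2) st.2.2.1 6),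
              powM (max q 2) st.2.2.1 3, st.2.2.2 / 3)
          else (mulM (max q 2) st.1 st.2.2.1, mulM (max q 2) st.2.1 (powM (max q 2) st.2.2.1 3),
              powM (max q 2) st.2.2.1 3, st.2.2.2 / 3))^[n] (x₀, b₀, c₀, E₀) →
          st.1 ≤ M ∧ st.2.1 ≤ M ∧ st.2.2.1 ≤ M ∧ st.2.2.2 ≤ M := by
        intro n
        induction n with
        | zero =>
          rintro st rfl
          simp only [Function.iterate_zero, id]
          omega
        | succ n ih =>
          rintro st rfl
          obtain ⟨h1, h2, h3, h4⟩ := ih _ rfl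
          rw [Function.iterate_succ_apply']
          split_ifs
          · exact ⟨h1, h2, hpow _ _, (Nat.div_le_self _ _).trans h4⟩
          · exact ⟨hmul _ _, hmul _ _, hpow _ _, (Nat.div_le_self _ _).trans h4⟩
          · exact ⟨hmul _ _, hmul _ _, hpow _ _, (Nat.div_le_self _ _).trans h4⟩
      obtain ⟨h1, h2, h3, h4⟩ := hinv l₁.length _ rfl
      -- sizes
      have hL : ∀ {u : ℕ}, u ≤ M → (natE u).length ≤ (natE M).length := fun hu => length_natE_mono hu
      have e1 := hL h1; have e2 := hL h2; have e3 := hL h3; have e4 := hL h4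
      simp only [eσ, eS, pairE_apply, length_boolPair, eval_add, eval_mul, eval_X, eval_ofNat] at e1 e2 e3 e4 ⊢
      -- `M < 2^(L + 3)` where `L` is the input length
      have hx0 := lt_two_pow_length_natE x₀
      have hb0 := lt_two_pow_length_natE b₀
      have hc0 := lt_two_pow_length_natE c₀
      have hE0 := lt_two_pow_length_natE E₀
      have hq0 := lt_two_pow_length_natE q
      set L := 2 * (2 * (2 * (natE q).length + 2 + (natE z).length) + 2 +
        (2 * (natE x₀).length + 2 + (2 * (natE b₀).length + 2 + (2 * (natE c₀).length + 2 +
          (natE E₀).length)))) + 2 + (rawE unitE (l₁ ++ l₂)).length with hLdef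
      have hpow2 : ∀ {u : ℕ} {k : ℕ}, u < 2 ^ k → k ≤ L → u < 2 ^ L := fun hu hk =>
        lt_of_lt_of_le hu (Nat.pow_le_pow_right (by norm_num) hk)
      have hM' : M < 2 ^ (L + 3) := by
        have := hpow2 hx0 (by omega)
        have := hpow2 hb0 (by omega)
        have := hpow2 hc0 (by omega)
        have := hpow2 hE0 (by omega)
        have := hpow2 hq0 (by omega)
        have h2L : 2 ≤ 2 ^ L := by
          calc (2 : ℕ) = 2 ^ 1 := rfl
            _ ≤ 2 ^ L := Nat.pow_le_pow_right (by norm_num) (by omega)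
        have : max q 2 < 2 ^ L + 2 := by omega
        rw [pow_add]
        norm_num
        omega
      have hML := length_natE_le_of_lt hM'
      omega)
  refine ((hfold.comp (((fst _ _).pair (snd _ _).fst').pair (replicateUnit.comp (snd _ _).snd'))).congr
    fun w => ?_)
  simp only
  rw [foldl_units_eq_iterate]

end CodeFP

end Literature.Computability.Complexity
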